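import Summits.HodgeConjecture.HodgeConjecture.Theorems.F0P6aCoverEOfComplexBody
import HarnessLib

/-!
# `F0P6aCoverEOfComplex` — ★ RE-HOME of `Lines/F0_P6a_CoverEOfComplex.lean`, PART 2 of 2 (size-lint split; cut at a declaration boundary).

## Import provenance
- `Theorems.F0P6aCoverEOfComplexBody` = ★ previous part of the same `Lines` workfile `F0_P6a_CoverEOfComplex` (size-lint split ×2); `HarnessLib`.

See PART 1 `Theorems/F0P6aCoverEOfComplexBody.lean` for the full re-home header and the original module docstring (verbatim there). Namespaces and sections KEPT
(re-opened below exactly as they stand at the cut, with their `open`∕`variable` lines replayed); code bytes = the workfile՚s, docstrings included; options preamble repeated from PART 1.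
HC_CM is proved only modulo the 7 printed citations (2 remaining: hLiu418 = stmt-HodgeConjecture-24832, h413 = stmt-HodgeConjecture-24833) until rung 0 closes; a re-home is count-neutral. -/

set_option autoImplicit false

noncomputable section

-- Mathlib's `Over`∕pull-back API is stated across semireducible wrappers (as in the ★ `AbelianSchemes/*` files).
set_option backward.isDefEq.respectTransparency false

namespace Summit.HodgeConjecture.HodgeConjecture.Cruxes.HLiu418.F0P6aCoverEOfComplex
open Summit.HodgeConjecture.HodgeConjecture.Cruxes.HLiu418.F0P6aEReadings
set_option linter.dupNamespace false
open CategoryTheory CategoryTheory.Limits NumberField IsDedekindDomain MulAction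
open scoped Matrix Pointwise
open Literature.NumberTheory.GaloisRepresentations
open Literature.NumberTheory.Automorphic Literature.NumberTheory.Automorphic.UnitaryGroup
open Literature.AlgebraicGeometry.ShimuraVarieties.UnitaryCanonicalModel
open Literature.NumberTheory.Automorphic.Liu2021.AppendixC
open Literature.AlgebraicGeometry.Motives (AlgPoints SchemeOver thickening thickeningLift specOver)
open Literature.AlgebraicGeometry.AbelianSchemes (AbelianSchemeOver)
open Literature.AlgebraicGeometry.AbelianSchemes.AbelianSchemeOver (baseChangeHom DualPair RingAction)


/-! ### §2 THE HEADS: `CoverKerE` ∕ `CoverE` at the `F̄_w`-sheet points from the bodies at complex (or any `Ω′`-) points -/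

section Heads

variable {F : Type} [Field F] [NumberField F] [IsCMField F] {ι₁ : F →+* ℂ} {Jstar : Matrix (Fin 2) (Fin 2) F}
  {K₀ : C5.OpenCompactSubgroup ↥(finAdelic ↥(maximalRealSubfield F) F (IsCMField.complexConj F) 2 Jstar)}
  (S : RecordSystemGS F Jstar ι₁ K₀) {Fi : Type} [Field Fi] [Algebra F Fi] (Kc : C5.SmallLevel K₀) (w : HeightOneSpectrum (𝓞 F))
  (univ : AbelianSchemeOver ((Literature.AlgebraicGeometry.Motives.baseChange F Fi).obj (S.M.obj Kc)).left)
  (act : RingAction (𝓞 F) univ) (dual : univ.DualPair)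
  (hD : Nonempty ((AlgebraicGeometry.Scheme.Modules.pullback dual.unitHatSlice).obj dual.P ≅ SheafOfModules.unit _))
  (pol : univ.Polarization dual) {g N : ℕ} (lvl : univ.LevelStructure g N)

/-! #### §2a From the body at ANY pair of `Ω′`-points over the sheet points (by value) -/

include hD in
/-- **`CoverKerE` AT THE SHEET POINTS FROM THE BODY AT ANY `(m, m′)` OVER `Ω′` ABOVE THEM**: for `x : Spec F̄_w → Spec Ω′` with `x ≫ m = (ℓ_e y).left`,
`x ≫ m′ = (ℓ_{e′} y).left`, `coverKerBody Ω′ … m m′ → CoverKerE … e … e′ 𝔞 n y`.  USE: `Ω′ := ℂ`, `x := Spec σ⁻¹`, `m := Spec σ ≫ (ℓ_e y).left`,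
`hm := Spec σ⁻¹ ≫ Spec σ = 𝟙` (★ `specMap_algEquiv_symm_comp_specMap`). [cite: Shimura1998, §13.1 Theorem 1 (pp. 97–99); §18.6 (pp. 124–127)]
[cite: MumfordFogartyKirwan1994, Ch. 7 §2 Definition 7.2 (p. 129)] -/
theorem coverKerE_of_readAt (e e' : Fi →ₐ[F] AlgebraicClosure (w.adicCompletion F)) (𝔞 : Ideal (𝓞 F)) (n : ℕ)
    (y : AlgPoints (S.M.obj Kc) (AlgebraicClosure (w.adicCompletion F))) {Ω' : Type} [Field Ω']
    (x : AlgebraicGeometry.Spec (.of (AlgebraicClosure (w.adicCompletion F))) ⟶ AlgebraicGeometry.Spec (.of Ω'))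
    (m m' : AlgebraicGeometry.Spec (.of Ω') ⟶ ((Literature.AlgebraicGeometry.Motives.baseChange F Fi).obj (S.M.obj Kc)).left)
    (hm : x ≫ m = (thickeningLift e (S.M.obj Kc) y).left) (hm' : x ≫ m' = (thickeningLift e' (S.M.obj Kc) y).left)
    (h : coverKerBody Ω' univ act dual pol lvl 𝔞 n m m') : CoverKerE S Kc w e univ act dual pol lvl e' 𝔞 n y :=
  (coverKerE_iff_coverKerBody S Kc w e univ act dual pol lvl e' 𝔞 n y).2
    (coverKerBody_of_eq _ Ω' univ act dual hD pol lvl 𝔞 n m m' x _ _ hm hm' h)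

include hD in
/-- **`CoverE` AT THE SHEET POINTS FROM THE BODY AT ANY `(m, m′)` OVER `Ω′` ABOVE THEM** (no kernel clause). [cite: Shimura1998, §13.1 Theorem 1 (pp. 97–99); §18.6 (pp. 124–127)]
[cite: MumfordFogartyKirwan1994, Ch. 7 §2 Definition 7.2 (p. 129)] -/
theorem coverE_of_readAt (e e' : Fi →ₐ[F] AlgebraicClosure (w.adicCompletion F)) (𝔞 : Ideal (𝓞 F)) (n : ℕ)
    (y : AlgPoints (S.M.obj Kc) (AlgebraicClosure (w.adicCompletion F))) {Ω' : Type} [Field Ω']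
    (x : AlgebraicGeometry.Spec (.of (AlgebraicClosure (w.adicCompletion F))) ⟶ AlgebraicGeometry.Spec (.of Ω'))
    (m m' : AlgebraicGeometry.Spec (.of Ω') ⟶ ((Literature.AlgebraicGeometry.Motives.baseChange F Fi).obj (S.M.obj Kc)).left)
    (hm : x ≫ m = (thickeningLift e (S.M.obj Kc) y).left) (hm' : x ≫ m' = (thickeningLift e' (S.M.obj Kc) y).left)
    (h : coverBody Ω' univ act dual pol lvl 𝔞 n m m') : CoverE S Kc w e univ act dual pol lvl e' 𝔞 n y :=
  (coverE_iff_coverBody S Kc w e univ act dual pol lvl e' 𝔞 n y).2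
    (coverBody_of_eq _ Ω' univ act dual hD pol lvl 𝔞 n m m' x _ _ hm hm' h)

include hD in
/-- **THE FORWARD DIRECTION**: `CoverKerE … y` gives `coverKerBody Ω′ … (x ≫ ℓ_e y) (x ≫ ℓ_{e′} y)` for ANY `x : Spec Ω′ → Spec F̄_w` (e.g. `x := Spec σ`,
the complex points of the sheet points). [cite: Shimura1998, §13.1 Theorem 1 (pp. 97–99); §18.6 (pp. 124–127)] [cite: MumfordFogartyKirwan1994, Ch. 7 §2 Definition 7.2 (p. 129)] -/
theorem coverKerBody_comp_of_coverKerE (e e' : Fi →ₐ[F] AlgebraicClosure (w.adicCompletion F)) (𝔞 : Ideal (𝓞 F)) (n : ℕ)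
    (y : AlgPoints (S.M.obj Kc) (AlgebraicClosure (w.adicCompletion F))) {Ω' : Type} [Field Ω']
    (x : AlgebraicGeometry.Spec (.of Ω') ⟶ AlgebraicGeometry.Spec (.of (AlgebraicClosure (w.adicCompletion F))))
    (h : CoverKerE S Kc w e univ act dual pol lvl e' 𝔞 n y) :
    coverKerBody Ω' univ act dual pol lvl 𝔞 n (x ≫ (thickeningLift e (S.M.obj Kc) y).left) (x ≫ (thickeningLift e' (S.M.obj Kc) y).left) :=
  coverKerBody_of_eq Ω' _ univ act dual hD pol lvl 𝔞 n _ _ x _ _ rfl rfl ((coverKerE_iff_coverKerBody S Kc w e univ act dual pol lvl e' 𝔞 n y).1 h)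

include hD in
/-- **THE FORWARD DIRECTION (no kernel clause)**: `CoverE … y` gives `coverBody Ω′ … (x ≫ ℓ_e y) (x ≫ ℓ_{e′} y)` for ANY `x : Spec Ω′ → Spec F̄_w`.
[cite: Shimura1998, §13.1 Theorem 1 (pp. 97–99); §18.6 (pp. 124–127)] [cite: MumfordFogartyKirwan1994, Ch. 7 §2 Definition 7.2 (p. 129)] -/
theorem coverBody_comp_of_coverE (e e' : Fi →ₐ[F] AlgebraicClosure (w.adicCompletion F)) (𝔞 : Ideal (𝓞 F)) (n : ℕ)
    (y : AlgPoints (S.M.obj Kc) (AlgebraicClosure (w.adicCompletion F))) {Ω' : Type} [Field Ω']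
    (x : AlgebraicGeometry.Spec (.of Ω') ⟶ AlgebraicGeometry.Spec (.of (AlgebraicClosure (w.adicCompletion F))))
    (h : CoverE S Kc w e univ act dual pol lvl e' 𝔞 n y) :
    coverBody Ω' univ act dual pol lvl 𝔞 n (x ≫ (thickeningLift e (S.M.obj Kc) y).left) (x ≫ (thickeningLift e' (S.M.obj Kc) y).left) :=
  coverBody_of_eq Ω' _ univ act dual hD pol lvl 𝔞 n _ _ x _ _ rfl rfl ((coverE_iff_coverBody S Kc w e univ act dual pol lvl e' 𝔞 n y).1 h)

/-! #### §2b From the body at the PUSHED sheet points along `σ : F̄_w ≃ₐ[F] Ω′` -/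

include hD in
/-- **`CoverKerE` AT `F̄_w`-POINTS FROM THE BODY AT THE PUSHED SHEET POINTS ALONG `σ : F̄_w ≃ₐ[F] Ω′`**: for `y′` with `y′.left = Spec σ ≫ y.left` (the point
`σ_* y`), the body at `(ℓ_{σ∘e} y′, ℓ_{σ∘e′} y′)` over `Ω′` gives `CoverKerE … e … e′ 𝔞 n y` — §2a at `x := Spec σ⁻¹` and `(ℓ_e y).left = Spec σ⁻¹ ≫ (ℓ_{σ∘e} y′).left`
(★ `thickeningLift_left_eq_specMap_symm_comp_of_left_eq`; ALWAYS `σ.toAlgHom`, never the coercion). [cite: Shimura1998, §13.1 Theorem 1 (pp. 97–99); §18.6 (pp. 124–127)]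
[cite: GortzWedhorn2020, Section (4.8)–(4.9)] -/
theorem coverKerE_of_algEquiv (e e' : Fi →ₐ[F] AlgebraicClosure (w.adicCompletion F)) (𝔞 : Ideal (𝓞 F)) (n : ℕ)
    (y : AlgPoints (S.M.obj Kc) (AlgebraicClosure (w.adicCompletion F))) {Ω' : Type} [Field Ω'] [Algebra F Ω']
    (σ : AlgebraicClosure (w.adicCompletion F) ≃ₐ[F] Ω') (y' : AlgPoints (S.M.obj Kc) Ω')
    (hy' : y'.left = AlgebraicGeometry.Spec.map (CommRingCat.ofHom σ.toAlgHom.toRingHom) ≫ y.left)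
    (h : coverKerBody Ω' univ act dual pol lvl 𝔞 n (thickeningLift (σ.toAlgHom.comp e) (S.M.obj Kc) y').left
      (thickeningLift (σ.toAlgHom.comp e') (S.M.obj Kc) y').left) :
    CoverKerE S Kc w e univ act dual pol lvl e' 𝔞 n y :=
  coverKerE_of_readAt S Kc w univ act dual hD pol lvl e e' 𝔞 n y (AlgebraicGeometry.Spec.map (CommRingCat.ofHom σ.symm.toAlgHom.toRingHom)) _ _
    (Literature.AlgebraicGeometry.Motives.thickeningLift_left_eq_specMap_symm_comp_of_left_eq e σ (S.M.obj Kc) y y' hy').symm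
    (Literature.AlgebraicGeometry.Motives.thickeningLift_left_eq_specMap_symm_comp_of_left_eq e' σ (S.M.obj Kc) y y' hy').symm h

include hD in
/-- **`CoverE` AT `F̄_w`-POINTS FROM THE BODY AT THE PUSHED SHEET POINTS ALONG `σ : F̄_w ≃ₐ[F] Ω′`** (no kernel clause). [cite: Shimura1998, §13.1 Theorem 1 (pp. 97–99); §18.6 (pp. 124–127)]
[cite: GortzWedhorn2020, Section (4.8)–(4.9)] -/
theorem coverE_of_algEquiv (e e' : Fi →ₐ[F] AlgebraicClosure (w.adicCompletion F)) (𝔞 : Ideal (𝓞 F)) (n : ℕ)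
    (y : AlgPoints (S.M.obj Kc) (AlgebraicClosure (w.adicCompletion F))) {Ω' : Type} [Field Ω'] [Algebra F Ω']
    (σ : AlgebraicClosure (w.adicCompletion F) ≃ₐ[F] Ω') (y' : AlgPoints (S.M.obj Kc) Ω')
    (hy' : y'.left = AlgebraicGeometry.Spec.map (CommRingCat.ofHom σ.toAlgHom.toRingHom) ≫ y.left)
    (h : coverBody Ω' univ act dual pol lvl 𝔞 n (thickeningLift (σ.toAlgHom.comp e) (S.M.obj Kc) y').left
      (thickeningLift (σ.toAlgHom.comp e') (S.M.obj Kc) y').left) :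
    CoverE S Kc w e univ act dual pol lvl e' 𝔞 n y :=
  coverE_of_readAt S Kc w univ act dual hD pol lvl e e' 𝔞 n y (AlgebraicGeometry.Spec.map (CommRingCat.ofHom σ.symm.toAlgHom.toRingHom)) _ _
    (Literature.AlgebraicGeometry.Motives.thickeningLift_left_eq_specMap_symm_comp_of_left_eq e σ (S.M.obj Kc) y y' hy').symm
    (Literature.AlgebraicGeometry.Motives.thickeningLift_left_eq_specMap_symm_comp_of_left_eq e' σ (S.M.obj Kc) y y' hy').symm h

/-! #### §2c From the bodies at COMPLEX points (`ℂ` an `F`-algebra through `ι₁`) -/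

include hD in
/-- **`CoverKerE` BETWEEN THE SHEETS `e′`, `e′ ∘ γ` AT `F̄_w`-POINTS FROM THE COMPLEX ROWS ON ALL COMPLEX SHEETS**: if for every complex sheet `eℂ : Fᵢ →ₐ[F] ℂ` and
every complex point `z` the body holds at `(ℓ_{eℂ} z, ℓ_{eℂ∘γ} z)`, then `CoverKerE … e′ … (e′ ∘ γ) 𝔞 n y` for every `F̄_w`-sheet `e′` and `F̄_w`-point `y` — §2b
along a `σ : F̄_w ≃ₐ[F] ℂ` over `ι₁` (★ `nonempty_algEquiv_algebraicClosure_adicCompletion_complex`) at `eℂ := σ ∘ e′`, `z := σ_* y`.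
[cite: Shimura1998, §13.1 Theorem 1 (pp. 97–99); §18.6 (pp. 124–127)] [cite: Lang2002, Ch. VIII §1 and Ch. V §2 Thm. 2.8] -/
theorem coverKerE_of_complex (γ : Fi →ₐ[F] Fi) (𝔞 : Ideal (𝓞 F)) (n : ℕ)
    (hℂ : letI : Algebra F ℂ := ι₁.toAlgebra
      ∀ (eℂ : Fi →ₐ[F] ℂ) (z : AlgPoints (S.M.obj Kc) ℂ),
        coverKerBody ℂ univ act dual pol lvl 𝔞 n (thickeningLift eℂ (S.M.obj Kc) z).left (thickeningLift (eℂ.comp γ) (S.M.obj Kc) z).left)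
    (e' : Fi →ₐ[F] AlgebraicClosure (w.adicCompletion F)) (y : AlgPoints (S.M.obj Kc) (AlgebraicClosure (w.adicCompletion F))) :
    CoverKerE S Kc w e' univ act dual pol lvl (e'.comp γ) 𝔞 n y := by
  letI : Algebra F ℂ := ι₁.toAlgebra
  obtain ⟨σ⟩ := Literature.FieldTheory.AlgClosed.nonempty_algEquiv_algebraicClosure_adicCompletion_complex F w ι₁
  exact coverKerE_of_algEquiv S Kc w univ act dual hD pol lvl e' (e'.comp γ) 𝔞 n y σ
    (AlgPoints.mk (AlgebraicGeometry.Spec.map (CommRingCat.ofHom σ.toAlgHom.toRingHom) ≫ y.left)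
      (Literature.AlgebraicGeometry.Motives.specMap_comp_algPoints_hom σ.toAlgHom (S.M.obj Kc) y)) rfl
    (hℂ (σ.toAlgHom.comp e') _)

include hD in
/-- **`CoverE` BETWEEN THE SHEETS `e′`, `e′ ∘ γ` AT `F̄_w`-POINTS FROM THE COMPLEX ROWS ON ALL COMPLEX SHEETS** (no kernel clause).
[cite: Shimura1998, §13.1 Theorem 1 (pp. 97–99); §18.6 (pp. 124–127)] [cite: Lang2002, Ch. VIII §1 and Ch. V §2 Thm. 2.8] -/
theorem coverE_of_complex (γ : Fi →ₐ[F] Fi) (𝔞 : Ideal (𝓞 F)) (n : ℕ)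
    (hℂ : letI : Algebra F ℂ := ι₁.toAlgebra
      ∀ (eℂ : Fi →ₐ[F] ℂ) (z : AlgPoints (S.M.obj Kc) ℂ),
        coverBody ℂ univ act dual pol lvl 𝔞 n (thickeningLift eℂ (S.M.obj Kc) z).left (thickeningLift (eℂ.comp γ) (S.M.obj Kc) z).left)
    (e' : Fi →ₐ[F] AlgebraicClosure (w.adicCompletion F)) (y : AlgPoints (S.M.obj Kc) (AlgebraicClosure (w.adicCompletion F))) :
    CoverE S Kc w e' univ act dual pol lvl (e'.comp γ) 𝔞 n y := by
  letI : Algebra F ℂ := ι₁.toAlgebra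
  obtain ⟨σ⟩ := Literature.FieldTheory.AlgClosed.nonempty_algEquiv_algebraicClosure_adicCompletion_complex F w ι₁
  exact coverE_of_algEquiv S Kc w univ act dual hD pol lvl e' (e'.comp γ) 𝔞 n y σ
    (AlgPoints.mk (AlgebraicGeometry.Spec.map (CommRingCat.ofHom σ.toAlgHom.toRingHom) ≫ y.left)
      (Literature.AlgebraicGeometry.Motives.specMap_comp_algPoints_hom σ.toAlgHom (S.M.obj Kc) y)) rfl
    (hℂ (σ.toAlgHom.comp e') _)

/-! #### §2d From the bodies on ONE complex sheet `τ` (the chart sheet), `σ` RELATIVE to the `F̄_w`-sheet (★ ED. 2 p850285), `Fᵢ` a number field -/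

include hD in
/-- **`CoverKerE` AT EVERY `F̄_w`-SHEET FROM THE COMPLEX ROWS ON ONE COMPLEX SHEET `τ`** (`Fᵢ` a number field): if the body holds at `(ℓ_τ z, ℓ_{τ∘γ} z)` for every
complex point `z` of ONE complex sheet `τ : Fᵢ →ₐ[F] ℂ`, then `CoverKerE … e′ … (e′ ∘ γ) 𝔞 n y` for EVERY `F̄_w`-sheet `e′` and point `y` — along the
`σ : F̄_w ≃ₐ[F] ℂ` RELATIVE TO THE SHEET, `σ ∘ e′ = τ` (★ ED. 2 `exists_algEquiv_algebraicClosure_adicCompletion_complex_apply_eq`). [cite: Shimura1998, §13.1 Theorem 1 (pp. 97–99); §18.6 (pp. 124–127)]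
[cite: Lang2002, Ch. VIII §1 and Ch. V §2 Thm. 2.8] -/
theorem coverKerE_of_complex_sheet [NumberField Fi] (γ : Fi →ₐ[F] Fi) (𝔞 : Ideal (𝓞 F)) (n : ℕ)
    (τ : letI : Algebra F ℂ := ι₁.toAlgebra; Fi →ₐ[F] ℂ)
    (hℂ : letI : Algebra F ℂ := ι₁.toAlgebra
      ∀ z : AlgPoints (S.M.obj Kc) ℂ,
        coverKerBody ℂ univ act dual pol lvl 𝔞 n (thickeningLift τ (S.M.obj Kc) z).left (thickeningLift (τ.comp γ) (S.M.obj Kc) z).left)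
    (e' : Fi →ₐ[F] AlgebraicClosure (w.adicCompletion F)) (y : AlgPoints (S.M.obj Kc) (AlgebraicClosure (w.adicCompletion F))) :
    CoverKerE S Kc w e' univ act dual pol lvl (e'.comp γ) 𝔞 n y := by
  letI : Algebra F ℂ := ι₁.toAlgebra
  obtain ⟨σ, hσ⟩ := Literature.FieldTheory.AlgClosed.exists_algEquiv_algebraicClosure_adicCompletion_complex_apply_eq F w ι₁ e'
    τ.toRingHom (by ext a; exact τ.commutes a)
  have hστ : σ.toAlgHom.comp e' = τ := AlgHom.ext fun a => hσ a
  refine coverKerE_of_algEquiv S Kc w univ act dual hD pol lvl e' (e'.comp γ) 𝔞 n y σ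
    (AlgPoints.mk (AlgebraicGeometry.Spec.map (CommRingCat.ofHom σ.toAlgHom.toRingHom) ≫ y.left)
      (Literature.AlgebraicGeometry.Motives.specMap_comp_algPoints_hom σ.toAlgHom (S.M.obj Kc) y)) rfl ?_
  rw [← AlgHom.comp_assoc, hστ]
  exact hℂ _

include hD in
/-- **`CoverE` AT EVERY `F̄_w`-SHEET FROM THE COMPLEX ROWS ON ONE COMPLEX SHEET `τ`** (no kernel clause; `Fᵢ` a number field).
[cite: Shimura1998, §13.1 Theorem 1 (pp. 97–99); §18.6 (pp. 124–127)] [cite: Lang2002, Ch. VIII §1 and Ch. V §2 Thm. 2.8] -/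
theorem coverE_of_complex_sheet [NumberField Fi] (γ : Fi →ₐ[F] Fi) (𝔞 : Ideal (𝓞 F)) (n : ℕ)
    (τ : letI : Algebra F ℂ := ι₁.toAlgebra; Fi →ₐ[F] ℂ)
    (hℂ : letI : Algebra F ℂ := ι₁.toAlgebra
      ∀ z : AlgPoints (S.M.obj Kc) ℂ,
        coverBody ℂ univ act dual pol lvl 𝔞 n (thickeningLift τ (S.M.obj Kc) z).left (thickeningLift (τ.comp γ) (S.M.obj Kc) z).left)
    (e' : Fi →ₐ[F] AlgebraicClosure (w.adicCompletion F)) (y : AlgPoints (S.M.obj Kc) (AlgebraicClosure (w.adicCompletion F))) :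
    CoverE S Kc w e' univ act dual pol lvl (e'.comp γ) 𝔞 n y := by
  letI : Algebra F ℂ := ι₁.toAlgebra
  obtain ⟨σ, hσ⟩ := Literature.FieldTheory.AlgClosed.exists_algEquiv_algebraicClosure_adicCompletion_complex_apply_eq F w ι₁ e'
    τ.toRingHom (by ext a; exact τ.commutes a)
  have hστ : σ.toAlgHom.comp e' = τ := AlgHom.ext fun a => hσ a
  refine coverE_of_algEquiv S Kc w univ act dual hD pol lvl e' (e'.comp γ) 𝔞 n y σ
    (AlgPoints.mk (AlgebraicGeometry.Spec.map (CommRingCat.ofHom σ.toAlgHom.toRingHom) ≫ y.left)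
      (Literature.AlgebraicGeometry.Motives.specMap_comp_algPoints_hom σ.toAlgHom (S.M.obj Kc) y)) rfl ?_
  rw [← AlgHom.comp_assoc, hστ]
  exact hℂ _

end Heads

/-! ### §3 ROAD B′ GLUE (LA4-plan (g2) 07:43:53Z): a cover ONTO ANY TARGET `B` over `Spec Ω` (e.g. the Serre tensor `A_x ⊗ 𝔞⁻¹` of ONE complex fibre) followed by an
EXACT ISOMORPHISM `B ≅ (univ)_{ℓ′}` (the (M3)∕LEG-C identification with the fibre on the sheet `τE ∘ γ`) IS the body at `(ℓ, ℓ′)` — ★ `coverKer_transport_along_iso` with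
`e := Iso.refl`, the identity side՚s bookkeeping (`(𝟙)^∨ = 𝟙` ★ `dualIsogenyOver_id'`, `AlgPoints.map (𝟙 _) = id`) discharged here -/

section Glue

variable {F : Type} [Field F] [NumberField F] [IsCMField F] {Y : AlgebraicGeometry.Scheme.{0}} (Ω : Type) [Field Ω]
  (univ : AbelianSchemeOver Y) (act : RingAction (𝓞 F) univ) (dual : univ.DualPair)
  (hD : Nonempty ((AlgebraicGeometry.Scheme.Modules.pullback dual.unitHatSlice).obj dual.P ≅ SheafOfModules.unit _))
  (pol : univ.Polarization dual) {g N : ℕ} (lvl : univ.LevelStructure g N) (𝔞 : Ideal (𝓞 F)) (n : ℕ)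
  (ℓ ℓ' : AlgebraicGeometry.Spec (.of Ω) ⟶ Y)
  {B : AbelianSchemeOver (AlgebraicGeometry.Spec (.of Ω))} (DB : B.DualPair)
  (hDB : Nonempty ((AlgebraicGeometry.Scheme.Modules.pullback DB.unitHatSlice).obj DB.P ≅ SheafOfModules.unit _))
  (lamB : B.X ⟶ DB.hat.X) (actB : 𝓞 F → (B.X ⟶ B.X))
  (ptB : (Fin g ⊕ Fin g → ZMod N) → B.toAffine.toAbelianVariety.Points Ω)
  (ε' : B.X ≅ (univ.baseChange ℓ').X) [IsMonHom ε'.hom]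

include hD hDB in
set_option maxHeartbeats 400000 in
open scoped MonObj Obj in
/-- **ROAD B′ GLUE (kernel-clause form).**  A cover `c : (univ)_ℓ → B` onto ANY group scheme `B` over `Spec Ω` with the seven `CoverKerE` clauses read with
`B`՚s own structure `(DB, lamB, actB, ptB)` — e.g. `B := A_x ⊗_{𝒪_F} 𝔞⁻¹`, the Serre tensor of the ONE complex fibre `A_x = (univ)_ℓ` (★ `SerreTensorConstruction` ∕
`SerreTensorIntegralIdealCover[Kernel]`, kernel exactly `A_x[𝔞]`) — followed by an isomorphism `ε′ : B ≅ (univ)_{ℓ′}` EXACT on `λ` (dual-homomorphism form), on the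
`𝒪_F`-action and on the level points (the (M3)∕LEG-C identification of the marked twist with the fibre on the sheet `τE ∘ γ`, ★ `exists_iso_exact_of_tupleRel_id_point`)
gives `coverKerBody Ω univ act dual pol lvl 𝔞 n ℓ ℓ′` — ★ `coverKer_transport_along_iso` at `e := Iso.refl`, `e′ := ε′`.
[cite: Shimura1998, §13.1 Theorem 1 (pp. 97–99); §18.6 (pp. 124–127)] [cite: MumfordFogartyKirwan1994, Ch. 7 §2 Definition 7.2 (p. 129) and Definition 7.3 (p. 130)] -/
theorem coverKerBody_of_cover_onto_iso
    (hlam' : ε'.hom ≫ (pol.baseChange ℓ').lam ≫ DualPair.dualIsogenyOver ε'.hom DB (dual.baseChange ℓ') = lamB)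
    (hact' : ∀ a : 𝓞 F, actB a ≫ ε'.hom = ε'.hom ≫ baseChangeHom (act.i a) ℓ')
    (hpt' : ∀ a : Fin g ⊕ Fin g → ZMod N,
      (AlgPoints.map ε'.hom (ptB a) : (univ.baseChange ℓ').toAffine.toAbelianVariety.Points Ω) = univ.restrictPt ℓ' (lvl.section_ a))
    (hcover : ∃ (c : (univ.baseChange ℓ).X ⟶ B.X) (_ : IsMonHom c),
        (∀ a ∈ 𝔞, ∃ d : B.X ⟶ (univ.baseChange ℓ).X, c ≫ d = baseChangeHom (act.i a) ℓ ∧ d ≫ c = actB a) ∧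
        (∀ ⦃T : SchemeOver Ω⦄ (t : T ⟶ (univ.baseChange ℓ).X), t ≫ c = 1 ↔ ∀ a ∈ 𝔞, t ≫ baseChangeHom (act.i a) ℓ = 1) ∧
        (∀ b ∈ (IsCMField.complexConj F) • 𝔞, ∃ f : (univ.baseChange ℓ).X ⟶ B.X, c ≫ actB b = f ≫ actB (n : 𝓞 F)) ∧
        c ≫ lamB ≫ DualPair.dualIsogenyOver c (dual.baseChange ℓ) DB = (pol.baseChange ℓ).lam ≫ (dual.baseChange ℓ).hat.mulN n ∧
        (∀ a : 𝓞 F, baseChangeHom (act.i a) ℓ ≫ c = c ≫ actB a) ∧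
        (∀ a : Fin g ⊕ Fin g → ZMod N, (AlgPoints.map c (univ.restrictPt ℓ (lvl.section_ a)) : B.toAffine.toAbelianVariety.Points Ω) = ptB a)) :
    coverKerBody Ω univ act dual pol lvl 𝔞 n ℓ ℓ' := by
  haveI : IsMonHom (Iso.refl (univ.baseChange ℓ).X).hom := (inferInstance : IsMonHom (𝟙 _))
  have hDℓ := DualPair.nonempty_unitHatSlice_baseChange_iso (g := ℓ) dual hD
  have hDℓ' := DualPair.nonempty_unitHatSlice_baseChange_iso (g := ℓ') dual hD
  -- `(𝟙)^∨ = 𝟙` through ★ `dualIsogenyOver_congr` (the instance argument depends on the morphism) and ★ `dualIsogenyOver_id'`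
  have h1 : DualPair.dualIsogenyOver (Iso.refl (univ.baseChange ℓ).X).hom (dual.baseChange ℓ) (dual.baseChange ℓ) = 𝟙 _ :=
    (Literature.AlgebraicGeometry.AbelianSchemes.AbelianSchemeOver.DualPair.dualIsogenyOver_congr (dual.baseChange ℓ) (dual.baseChange ℓ)
      (ψ₁ := (Iso.refl (univ.baseChange ℓ).X).hom) (ψ₂ := 𝟙 _) (Iso.refl_hom _)).trans
      (Literature.AlgebraicGeometry.AbelianSchemes.AbelianSchemeOver.DualPair.dualIsogenyOver_id' (dual.baseChange ℓ) hDℓ)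
  have he : (Iso.refl (univ.baseChange ℓ).X).hom ≫ (pol.baseChange ℓ).lam ≫
      DualPair.dualIsogenyOver (Iso.refl (univ.baseChange ℓ).X).hom (dual.baseChange ℓ) (dual.baseChange ℓ) = (pol.baseChange ℓ).lam := by
    rw [h1, Category.comp_id, Iso.refl_hom, Category.id_comp]
  exact Literature.AlgebraicGeometry.AbelianSchemes.AbelianSchemeOver.coverKer_transport_along_iso
    (dual.baseChange ℓ) (dual.baseChange ℓ) DB (dual.baseChange ℓ') hDℓ hDℓ hDB hDℓ'
    (pol.baseChange ℓ).lam (pol.baseChange ℓ).lam lamB (pol.baseChange ℓ').lam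
    (fun a => baseChangeHom (act.i a) ℓ) (fun a => baseChangeHom (act.i a) ℓ) actB (fun a => baseChangeHom (act.i a) ℓ')
    (fun a => univ.restrictPt ℓ (lvl.section_ a)) (fun a => univ.restrictPt ℓ (lvl.section_ a)) ptB (fun a => univ.restrictPt ℓ' (lvl.section_ a))
    (fun a => a ∈ 𝔞) (fun b => b ∈ (IsCMField.complexConj F) • 𝔞) ((n : ℕ) : 𝓞 F) (Iso.refl _) ε' n he hlam'
    (fun a => by rw [Iso.refl_hom, Category.comp_id, Category.id_comp]) hact'
    (fun a => by simp only [Iso.refl_hom, AlgPoints.map_id, id_eq]) hpt' hcover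

include hD hDB in
set_option maxHeartbeats 400000 in
/-- **ROAD B′ GLUE (no kernel clause)**: the same for the six `CoverE` clauses — ★ `cover_transport_along_iso` at `e := Iso.refl`, `e′ := ε′`.
[cite: Shimura1998, §13.1 Theorem 1 (pp. 97–99); §18.6 (pp. 124–127)] [cite: MumfordFogartyKirwan1994, Ch. 7 §2 Definition 7.2 (p. 129) and Definition 7.3 (p. 130)] -/
theorem coverBody_of_cover_onto_iso
    (hlam' : ε'.hom ≫ (pol.baseChange ℓ').lam ≫ DualPair.dualIsogenyOver ε'.hom DB (dual.baseChange ℓ') = lamB)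
    (hact' : ∀ a : 𝓞 F, actB a ≫ ε'.hom = ε'.hom ≫ baseChangeHom (act.i a) ℓ')
    (hpt' : ∀ a : Fin g ⊕ Fin g → ZMod N,
      (AlgPoints.map ε'.hom (ptB a) : (univ.baseChange ℓ').toAffine.toAbelianVariety.Points Ω) = univ.restrictPt ℓ' (lvl.section_ a))
    (hcover : ∃ (c : (univ.baseChange ℓ).X ⟶ B.X) (_ : IsMonHom c),
        (∀ a ∈ 𝔞, ∃ d : B.X ⟶ (univ.baseChange ℓ).X, c ≫ d = baseChangeHom (act.i a) ℓ ∧ d ≫ c = actB a) ∧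
        (∀ b ∈ (IsCMField.complexConj F) • 𝔞, ∃ f : (univ.baseChange ℓ).X ⟶ B.X, c ≫ actB b = f ≫ actB (n : 𝓞 F)) ∧
        c ≫ lamB ≫ DualPair.dualIsogenyOver c (dual.baseChange ℓ) DB = (pol.baseChange ℓ).lam ≫ (dual.baseChange ℓ).hat.mulN n ∧
        (∀ a : 𝓞 F, baseChangeHom (act.i a) ℓ ≫ c = c ≫ actB a) ∧
        (∀ a : Fin g ⊕ Fin g → ZMod N, (AlgPoints.map c (univ.restrictPt ℓ (lvl.section_ a)) : B.toAffine.toAbelianVariety.Points Ω) = ptB a)) :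
    coverBody Ω univ act dual pol lvl 𝔞 n ℓ ℓ' := by
  haveI : IsMonHom (Iso.refl (univ.baseChange ℓ).X).hom := (inferInstance : IsMonHom (𝟙 _))
  have hDℓ := DualPair.nonempty_unitHatSlice_baseChange_iso (g := ℓ) dual hD
  have hDℓ' := DualPair.nonempty_unitHatSlice_baseChange_iso (g := ℓ') dual hD
  -- `(𝟙)^∨ = 𝟙` through ★ `dualIsogenyOver_congr` (the instance argument depends on the morphism) and ★ `dualIsogenyOver_id'`
  have h1 : DualPair.dualIsogenyOver (Iso.refl (univ.baseChange ℓ).X).hom (dual.baseChange ℓ) (dual.baseChange ℓ) = 𝟙 _ :=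
    (Literature.AlgebraicGeometry.AbelianSchemes.AbelianSchemeOver.DualPair.dualIsogenyOver_congr (dual.baseChange ℓ) (dual.baseChange ℓ)
      (ψ₁ := (Iso.refl (univ.baseChange ℓ).X).hom) (ψ₂ := 𝟙 _) (Iso.refl_hom _)).trans
      (Literature.AlgebraicGeometry.AbelianSchemes.AbelianSchemeOver.DualPair.dualIsogenyOver_id' (dual.baseChange ℓ) hDℓ)
  have he : (Iso.refl (univ.baseChange ℓ).X).hom ≫ (pol.baseChange ℓ).lam ≫
      DualPair.dualIsogenyOver (Iso.refl (univ.baseChange ℓ).X).hom (dual.baseChange ℓ) (dual.baseChange ℓ) = (pol.baseChange ℓ).lam := by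
    rw [h1, Category.comp_id, Iso.refl_hom, Category.id_comp]
  exact Literature.AlgebraicGeometry.AbelianSchemes.AbelianSchemeOver.cover_transport_along_iso
    (dual.baseChange ℓ) (dual.baseChange ℓ) DB (dual.baseChange ℓ') hDℓ hDℓ hDB hDℓ'
    (pol.baseChange ℓ).lam (pol.baseChange ℓ).lam lamB (pol.baseChange ℓ').lam
    (fun a => baseChangeHom (act.i a) ℓ) (fun a => baseChangeHom (act.i a) ℓ) actB (fun a => baseChangeHom (act.i a) ℓ')
    (fun a => univ.restrictPt ℓ (lvl.section_ a)) (fun a => univ.restrictPt ℓ (lvl.section_ a)) ptB (fun a => univ.restrictPt ℓ' (lvl.section_ a))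
    (fun a => a ∈ 𝔞) (fun b => b ∈ (IsCMField.complexConj F) • 𝔞) ((n : ℕ) : 𝓞 F) (Iso.refl _) ε' n he hlam'
    (fun a => by rw [Iso.refl_hom, Category.comp_id, Category.id_comp]) hact'
    (fun a => by simp only [Iso.refl_hom, AlgPoints.map_id, id_eq]) hpt' hcover

end Glue

end Summit.HodgeConjecture.HodgeConjecture.Cruxes.HLiu418.F0P6aCoverEOfComplex

end
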